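import Summits.Ventures.CertifiedArithmetic.LowPrec.DoubleRoundingDecision

/-!
# Equal precision: two formats round alike on their common normal band

HONEST FRAMING (venture CertifiedArithmetic / cell `pub-lowprec`): certified error envelopes and
provably optimal rounding/accumulation schemes for low-precision formats under stated cost models;
every table by two implementations; no hardware or vendor claims.

THE BAND LEMMA (`toRat_roundNE_eq_of_manBits_eq_band`): two parameter records `φ`, `ψ` with the
SAME trailing-significand width `m ≥ 1` — whatever their biases, exponent ranges and (possibly
truncated) tops, and whether or not one value set contains the other — round EVERY rational `x`
of the common normal band `max (2^m q_φ, 2^m q_ψ) ≤ |x| ≤ min (M_φ, M_ψ)` to the same value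
(saturating round-to-nearest-even `roundNE`). Example of a non-nested pair: e4m3 (`q = 2^-9`,
`M = 448`) and binary8p4 (`q = 2^-10`, `M = 224`) agree on `[2^-6, 224]` and disagree on both
sides of it (`roundNE_E4M3_Binary8p4_offBand`). Proof (§1, oriented case `L_ψ ≤ L_φ`; §2 by
symmetry and sign): a value of `φ` of modulus `≤ M_ψ` is a value of `ψ` (POINTWISE embedding
`exists_toRat_eq_of_abs_le`, `RoundTripDecision.lean`); if `x ∉ F_φ`, its `φ`-brackets
`v < x < u = v + ulp_φ(v)` (`roundDown_bracket`) are a NORMAL datum `v ≥ 2^m q_φ` and its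
successor, both of modulus `≤ M_ψ` (gap transport against the top of `ψ`), hence values of `ψ`,
and no value of `ψ` lies strictly between them (GAP TRANSPORT `gap_of_manBits_eq`,
`DoubleRoundingDecision.lean`); off the midpoint both roundings pick the nearer bracket, at the
midpoint both pick the bracket with the even significand — the same one on both sides (PARITY
TRANSPORT `two_dvd_man_iff_of_scaledMag_eq`, alternation `not_two_dvd_man_and_succ`). This is the
engine of `toRat_roundNE_eq_of_manBits_eq` (ibid. §2: multiples of the `φ`-quantum under the
GLOBAL embedding `L_ψ ≤ L_φ ∧ M_φ ≤ M_ψ`) with the hypotheses moved onto the POINT `x`.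

COROLLARY (`toRat_roundNE_roundNE_of_manBits_eq_band`): on that band `fl_φ (fl_ψ x) = fl_φ x` —
between two formats of equal precision a double-rounding slip, of ANY operation, requires the
exact result to lie in a subnormal range of one of them or beyond a top. (Sums of `φ`-data never
slip under the global embedding, `drAdd_of_manBits_eq`; quotients do, and only below `2^m q_φ`,
`DOUBLE-ROUNDING-DIV.md` §4b; square roots never leave the band: THEOREM E-sqrt,
`DoubleRoundingSqrtEqualPrecision.lean`, which turns the corollary into a parameter test deciding
the 13 named square-root cells that THEOREM D-sqrt had to close by exhaustion.)

TWO IMPLEMENTATIONS: A = `code/enum/sqrt_equal_law.py` Part 1 → `certs/enum/DOUBLE-ROUNDING-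
SQRT-EQUAL.json` (198 unordered pairs of pseudo-records of equal `m ∈ {1,2,3}` with varied biases,
ranges and truncated tops; `fl_φ = fl_ψ` checked EXHAUSTIVELY as step functions on
`[0, 9/8 · max M]` — grid of a quarter of the finer quantum, two RNE implementations per format:
`0` disagreements and `0` slips at the `34006` band points, `7620` disagreements below the band
and `192293` above it, so both band hypotheses are needed); B = the kernel (this file).
PLACEMENT — KNOWN in substance: FLT formats of equal precision coincide, as value sets and as
roundings, on the normal range `|x| ≥ β^(e_min + p - 1)` [BoldoMelquiond2017, §3.1.3.4 Fig. 3.1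
and the remark after Lemma 3.8] (Flocq, unbounded above, no tops); double rounding through a
register of the same precision and wider exponent range slips only at underflow (x87 precision
control: Golliver's store-reload/scaling as reported by Shudo–Muraoka 2000, §3.2, lit key
`paper:galaxy-pdf-6957003653025018000`); the general theory of innocuous double rounding treats
`p₂ > p₁` [Figueroa1995; MartinDorelMelquiondMuller2013, §2; Roux2014]. NEW here only: the finite
saturating form (truncated tops, non-nested value sets, ties-to-even on the encodings) over this
cell's `MiniFloat` records. No hardware or vendor claims.
-/

namespace Summit.Ventures.CertifiedArithmetic

open Literature.ComputerArithmetic.FloatingPoint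
open Literature.ComputerArithmetic.FloatingPoint.Format
open Literature.ComputerArithmetic.FloatingPoint.MiniFloat

/-! ## §1 The oriented case `L_ψ ≤ L_φ` -/

/-- A datum whose scaled magnitude reaches `2^m` is normal (`expCode ≥ 1`). [folklore] -/
theorem expCode_pos_of_pow_le_scaledMag {φ : Format} {v : MiniFloat φ}
    (h : 2 ^ φ.manBits ≤ v.scaledMag) : 1 ≤ v.expCode := by
  by_contra h0
  have h0 : v.expCode = 0 := by omega
  have := v.man_lt
  unfold MiniFloat.scaledMag Format.scaled at h
  rw [if_pos h0] at h
  omega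

/-- The smallest positive normal value `2^m q_φ` is a value of `φ` as soon as something of the
band `[2^m q_φ, M_φ]` exists. [folklore] -/
theorem exists_toRat_eq_pow_mul_quantum {φ : Format} {x : ℚ}
    (hlo : 2 ^ φ.manBits * φ.quantum ≤ x) (hφ : x ≤ φ.maxRat) :
    ∃ w : MiniFloat φ, w.toRat = 2 ^ φ.manBits * φ.quantum := by
  have hq := φ.quantum_pos
  refine exists_toRat_eq_of_isFloat ⟨2 ^ φ.manBits, φ.qexp, ?_, le_rfl, ?_⟩ ?_
  · rw [abs_of_nonneg (by positivity)]; exact_mod_cast Nat.pow_lt_pow_right (by norm_num) (by omega)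
  · unfold Format.quantum; push_cast; ring
  · rw [abs_of_nonneg (by positivity)]; exact hlo.trans hφ

/-- THE BAND LEMMA, oriented (`L_ψ ≤ L_φ`, `x > 0`): for `m_φ = m_ψ ≥ 1`, every rational `x` with
`2^m q_φ ≤ x ≤ min (M_φ, M_ψ)` rounds to the same value in `ψ` and in `φ`.
[this packet; cite: BoldoMelquiond2017, §3.1.3.4; cite: Figueroa1995, §2] -/
theorem toRat_roundNE_eq_of_manBits_eq_band_of_qexp_le {φ ψ : Format}
    (hm : φ.manBits = ψ.manBits) (h1 : 1 ≤ φ.manBits) (hq : ψ.qexp ≤ φ.qexp) {x : ℚ}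
    (hlo : 2 ^ φ.manBits * φ.quantum ≤ x) (hφ : x ≤ φ.maxRat) (hψ : x ≤ ψ.maxRat) :
    (roundNE ψ x).toRat = (roundNE φ x).toRat := by
  have hqφ := φ.quantum_pos
  have h0 : 0 < x := lt_of_lt_of_le (by positivity) hlo
  by_cases hex : ∃ y : MiniFloat φ, y.toRat = x
  · obtain ⟨y, hy⟩ := hex
    obtain ⟨z, hz⟩ := exists_toRat_eq_of_abs_le hm.le hq y (by rw [hy, abs_of_pos h0]; exact hψ)
    rw [toRat_roundNE_of_exists ⟨z, hz.trans hy⟩, toRat_roundNE_of_exists ⟨y, hy⟩]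
  have hlt : x < φ.maxRat := lt_of_le_of_ne hφ fun h => hex ⟨top φ, by rw [toRat_top, h]⟩
  obtain ⟨hv0, hvt, htu, ⟨u, hu⟩, hgap⟩ := roundDown_bracket h0 hlt hex
  set v := roundDown φ x with hv_def
  set G : ℚ := 2 ^ (v.expCode - 1) * φ.quantum with hG
  have hG0 : 0 < G := by positivity
  -- `v` is normal: it lies above the datum of value `2^m q_φ`
  obtain ⟨w, hw⟩ := exists_toRat_eq_pow_mul_quantum hlo hφ
  have hwv : w.toRat ≤ v.toRat :=
    toRat_le_roundDown (by rw [abs_of_pos h0]; exact hφ) w (by rw [hw]; exact hlo)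
  have h2m : 2 ^ φ.manBits ≤ v.scaledMag := by
    have : (2 : ℚ) ^ φ.manBits * φ.quantum ≤ v.scaledMag * φ.quantum := by
      rw [← hw, ← abs_toRat, abs_of_nonneg hv0]; exact hwv
    exact_mod_cast le_of_mul_le_mul_right this hqφ
  have hv1 : 1 ≤ v.expCode := expCode_pos_of_pow_le_scaledMag h2m
  obtain ⟨d, hd⟩ : ∃ d : ℕ, φ.quantum = 2 ^ d * ψ.quantum := ⟨_, quantum_eq_two_pow_mul hq⟩
  -- both brackets are values of `ψ`: `v < x ≤ M_ψ`, and `u = v + G ≤ M_ψ` by gap transport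
  -- against the top of `ψ`
  have huψ : v.toRat + G ≤ ψ.maxRat := by
    rcases gap_of_manBits_eq hm hd hv1 hv0 (top ψ) with h | h
    · rw [toRat_top] at h; linarith
    · rw [toRat_top] at h; exact h
  obtain ⟨zv, hzv⟩ := exists_toRat_eq_of_abs_le hm.le hq v
    (by rw [abs_of_nonneg hv0]; linarith)
  obtain ⟨zu, hzu⟩ := exists_toRat_eq_of_abs_le hm.le hq u
    (by rw [hu, abs_of_nonneg (by linarith)]; exact huψ)
  have hgapψ : ∀ y : MiniFloat ψ, y.toRat ≤ zv.toRat ∨ zv.toRat + G ≤ y.toRat := by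
    intro y; rw [hzv]; exact gap_of_manBits_eq hm hd hv1 hv0 y
  have hzu' : zu.toRat = zv.toRat + G := by rw [hzu, hzv, hu]
  rcases lt_trichotomy x (v.toRat + G / 2) with hlow | hmid | hhigh
  · rw [toRat_roundNE_eq_of_forall_lt ⟨zv, rfl⟩
        (forall_lt_of_mem_low hgapψ (by rw [hzv]; exact hvt.le) (by rw [hzv]; exact hlow)),
      toRat_roundNE_eq_of_forall_lt ⟨v, rfl⟩ (forall_lt_of_mem_low hgap hvt.le hlow), hzv]
  · -- THE TIE: both roundings lie in `{v, u}` and have an even significand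
    have hφ' : (roundNE φ x).toRat = v.toRat ∨ (roundNE φ x).toRat = u.toRat := by
      rcases hgap (roundNE φ x) with h | h
      · left
        have := roundNE_nearest x v
        rw [abs_of_nonneg (by linarith), abs_of_nonneg (by linarith)] at this
        linarith
      · right
        have := roundNE_nearest x u
        rw [abs_of_nonpos (by linarith), abs_of_nonpos (by linarith)] at this
        linarith
    have hψ' : (roundNE ψ x).toRat = v.toRat ∨ (roundNE ψ x).toRat = u.toRat := by
      rcases hgapψ (roundNE ψ x) with h | h
      · left
        have := roundNE_nearest x zv
        rw [hzv] at h this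
        rw [abs_of_nonneg (by linarith), abs_of_nonneg (by linarith)] at this
        linarith
      · right
        have := roundNE_nearest x zu
        rw [hzu] at this
        rw [hzv] at h
        rw [abs_of_nonpos (by linarith), abs_of_nonpos (by linarith)] at this
        linarith
    have habs1 : |x - u.toRat| = |x - v.toRat| := by
      rw [hu, hmid, show v.toRat + G / 2 - (v.toRat + G) = -(G / 2) by ring,
        show v.toRat + G / 2 - v.toRat = G / 2 by ring, abs_neg]
    have hne : u.toRat ≠ v.toRat := by rw [hu]; exact (lt_add_of_pos_right _ hG0).ne'
    have pφ : 2 ∣ (roundNE φ x).man := by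
      rcases hφ' with h | h
      · exact roundNE_man_even_of_tie h1 (y := u) (by rw [h, habs1]) (by rw [h]; exact hne)
      · exact roundNE_man_even_of_tie h1 (y := v) (by rw [h, habs1]) (by rw [h]; exact hne.symm)
    have pψ : 2 ∣ (roundNE ψ x).man := by
      rcases hψ' with h | h
      · exact roundNE_man_even_of_tie (hm ▸ h1) (y := zu) (by rw [h, hzu, habs1])
          (by rw [h, hzu]; exact hne)
      · exact roundNE_man_even_of_tie (hm ▸ h1) (y := zv) (by rw [h, hzv, habs1])
          (by rw [h, hzv]; exact hne.symm)
    -- `u` is normal too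
    have hSvu : v.scaledMag ≤ u.scaledMag := by
      have : (v.scaledMag : ℚ) * φ.quantum ≤ u.scaledMag * φ.quantum := by
        rw [← abs_toRat, ← abs_toRat, abs_of_nonneg hv0, abs_of_nonneg (by linarith)]; linarith
      exact_mod_cast le_of_mul_le_mul_right this hqφ
    have hu1 : 1 ≤ u.expCode := expCode_pos_of_pow_le_scaledMag (h2m.trans hSvu)
    have hd0 : φ.quantum = 2 ^ 0 * φ.quantum := by rw [pow_zero, one_mul]
    rcases hφ' with hrv | hru <;> rcases hψ' with hsv | hsu
    · rw [hsv, hrv]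
    · exfalso
      refine not_two_dvd_man_and_succ h1 hv0 hu ⟨?_, ?_⟩
      · exact (two_dvd_man_iff_of_scaledMag_eq rfl h1 hv1
          (scaledMag_eq_mul_of_abs_toRat_eq hd0 (by rw [hrv]))).mp pφ
      · exact (two_dvd_man_iff_of_scaledMag_eq hm h1 hu1
          (scaledMag_eq_mul_of_abs_toRat_eq hd (by rw [hsu]))).mp pψ
    · exfalso
      refine not_two_dvd_man_and_succ h1 hv0 hu ⟨?_, ?_⟩
      · exact (two_dvd_man_iff_of_scaledMag_eq hm h1 hv1
          (scaledMag_eq_mul_of_abs_toRat_eq hd (by rw [hsv]))).mp pψ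
      · exact (two_dvd_man_iff_of_scaledMag_eq rfl h1 hu1
          (scaledMag_eq_mul_of_abs_toRat_eq hd0 (by rw [hru]))).mp pφ
    · rw [hsu, hru]
  · rw [toRat_roundNE_eq_of_forall_lt ⟨zu, rfl⟩
        (forall_lt_of_mem_high hzu' hgapψ (by rw [hzv]; exact hhigh) (by rw [hzv]; exact htu.le)),
      toRat_roundNE_eq_of_forall_lt ⟨u, rfl⟩ (forall_lt_of_mem_high hu hgap hhigh htu.le), hzu]

/-! ## §2 The band lemma and its double-rounding corollary -/

/-- THE BAND LEMMA, positive arguments: for `m_φ = m_ψ ≥ 1`, every rational `x` with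
`max (2^m q_φ, 2^m q_ψ) ≤ x ≤ min (M_φ, M_ψ)` rounds to the same value in `ψ` and in `φ` — no
inclusion between the value sets is asked. [this packet; cite: BoldoMelquiond2017, §3.1.3.4] -/
theorem toRat_roundNE_eq_of_manBits_eq_band_pos {φ ψ : Format} (hm : φ.manBits = ψ.manBits)
    (h1 : 1 ≤ φ.manBits) {x : ℚ} (hloφ : 2 ^ φ.manBits * φ.quantum ≤ x)
    (hloψ : 2 ^ ψ.manBits * ψ.quantum ≤ x) (hφ : x ≤ φ.maxRat) (hψ : x ≤ ψ.maxRat) :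
    (roundNE ψ x).toRat = (roundNE φ x).toRat := by
  rcases le_total ψ.qexp φ.qexp with hq | hq
  · exact toRat_roundNE_eq_of_manBits_eq_band_of_qexp_le hm h1 hq hloφ hφ hψ
  · exact (toRat_roundNE_eq_of_manBits_eq_band_of_qexp_le hm.symm (hm ▸ h1) hq hloψ hψ hφ).symm

/-- THE BAND LEMMA: for `m_φ = m_ψ ≥ 1`, every rational `x` of the common normal band
`max (2^m q_φ, 2^m q_ψ) ≤ |x| ≤ min (M_φ, M_ψ)` rounds to the same value in `ψ` and in `φ`.
[this packet; cite: BoldoMelquiond2017, §3.1.3.4; cite: Figueroa1995, §2] -/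
theorem toRat_roundNE_eq_of_manBits_eq_band {φ ψ : Format} (hm : φ.manBits = ψ.manBits)
    (h1 : 1 ≤ φ.manBits) {x : ℚ} (hloφ : 2 ^ φ.manBits * φ.quantum ≤ |x|)
    (hloψ : 2 ^ ψ.manBits * ψ.quantum ≤ |x|) (hφ : |x| ≤ φ.maxRat) (hψ : |x| ≤ ψ.maxRat) :
    (roundNE ψ x).toRat = (roundNE φ x).toRat := by
  rcases le_or_gt 0 x with h0 | h0
  · rw [abs_of_nonneg h0] at hloφ hloψ hφ hψ
    exact toRat_roundNE_eq_of_manBits_eq_band_pos hm h1 hloφ hloψ hφ hψ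
  · rw [abs_of_neg h0] at hloφ hloψ hφ hψ
    have := toRat_roundNE_eq_of_manBits_eq_band_pos hm h1 hloφ hloψ hφ hψ
    rwa [toRat_roundNE_neg, toRat_roundNE_neg, neg_inj] at this

/-- COROLLARY — DOUBLE ROUNDING BETWEEN EQUAL PRECISIONS IS INNOCUOUS ON THE BAND: for
`m_φ = m_ψ ≥ 1` and `max (2^m q_φ, 2^m q_ψ) ≤ |x| ≤ min (M_φ, M_ψ)`, `fl_φ (fl_ψ x) = fl_φ x`;
a slip requires the exact result below a normal range or beyond a top.
[this packet; cite: BoldoMelquiond2017, §1.4.2; cite: Figueroa1995, §2] -/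
theorem toRat_roundNE_roundNE_of_manBits_eq_band {φ ψ : Format} (hm : φ.manBits = ψ.manBits)
    (h1 : 1 ≤ φ.manBits) {x : ℚ} (hloφ : 2 ^ φ.manBits * φ.quantum ≤ |x|)
    (hloψ : 2 ^ ψ.manBits * ψ.quantum ≤ |x|) (hφ : |x| ≤ φ.maxRat) (hψ : |x| ≤ ψ.maxRat) :
    (roundNE φ (roundNE ψ x).toRat).toRat = (roundNE φ x).toRat := by
  rw [toRat_roundNE_eq_of_manBits_eq_band hm h1 hloφ hloψ hφ hψ, toRat_roundNE_toRat]

/-! ## §3 Kernel instances: the band hypotheses are needed -/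

/-- e4m3 (`q = 2^-9`, `M = 448`) and binary8p4 (`q = 2^-10`, `M = 224`), neither containing the
other, agree at the band ends `2^-6` and `224` and differ just outside: below, `3·2^-10` is a
value of binary8p4 and the midpoint of the e4m3 subnormals `2^-9`, `2^-8` (to even: `2^-8`);
above, `240` is a value of e4m3 beyond binary8p4's top. -/
theorem roundNE_E4M3_Binary8p4_offBand :
    (roundNE Binary8p4 (3 / 1024 : ℚ)).toRat = 3 / 1024 ∧
    (roundNE E4M3 (3 / 1024 : ℚ)).toRat = 1 / 256 ∧
    (roundNE Binary8p4 (240 : ℚ)).toRat = 224 ∧ (roundNE E4M3 (240 : ℚ)).toRat = 240 ∧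
    (roundNE Binary8p4 (1 / 64 : ℚ)).toRat = (roundNE E4M3 (1 / 64 : ℚ)).toRat ∧
    (roundNE Binary8p4 (224 : ℚ)).toRat = (roundNE E4M3 (224 : ℚ)).toRat := by
  refine ⟨?_, ?_, ?_, ?_, ?_, ?_⟩ <;> decide +kernel

end Summit.Ventures.CertifiedArithmetic
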